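import Summits.NavierStokesRegularity.OSWSelfSimilar.SheetRLinearisedStabilityEvenRecord
import Summits.NavierStokesRegularity.OSWSelfSimilar.SheetREvenZeroMassCorrection
import HarnessLib

/-!
# SHEET-ℝ frame, EVEN ZERO-MASS class `E⁺₀`: THE DOMAIN OF KATO'S OPERATOR `T⁺` IS INVARIANT UNDER BOUNDED RE-ENCODINGS OF THE FORM
# — and the even stability word on the S2⁺ interface WITHOUT the domain binder `h⁺ ∈ D(T⁺*)`

HONEST FRAMING (cell ns-blowup GROUP B / zone Z3, case Z3-SR-SPEC EVEN half, HYPOTHESIS-LEDGER v2.4 row (P10)⁺, footnote «price disclosed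
as typed = the explicit domain binder `hf`»; 0 kit; 1-D MODEL certificate frame (viscous gCLM/OSW sheet on the line); not Euler/NS;
«violates: none — MODEL»). NOTHING here asserts that a hypothesis holds, and NOTHING here is interval arithmetic.

Two even encodings `(d, V, K)` and `(d′, V′, K′)` of a linearisation (drift, potential, bounded nonlocal part `EspE →L L²_w`) whose WEAK FORMS
ON ZERO-MASS EVEN TESTS DIFFER BY A BOUNDED TERM `∫ w·(Bp)·φ`, `B : EspE →L L²_w` (hypothesis `hB` below) — the same-coefficient case
`d′ = d`, `V′ = V` has `B = K′ − K`; cert-5 g9's `SheetREvenCentreReencoding.weakForm_reencodeE` is the case `B = B⁺_u` between the centre and the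
`Ω*` encodings — have Kato operators `T⁺ = generatorEven hL K h σ₀ _`, `T⁺′ = generatorEven hL K′ h′ σ₁ _` (any Gårding constants, any base
points) with
* §1 `isWeakImageE_of_weakForm_sub` — a weak image `IsWeakImageE hL K d V P F` is a weak image `IsWeakImageE hL K′ d′ V′ P (F + Z)` with `Z` in the
  even zero-mass class: `Z` is selfsim g15's EVEN ZERO-MASS CORRECTION (`SheetREvenZeroMassCorrection.evenZ_correction_mem` /
  `integral_weight_correction_mul_test`: `g_e − (L/π)(∫g_e)·w⁻¹ ∈ WevenZ` pairs with zero-mass even tests like `g`) of `(BP₁, BP₂)`;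
* §2 **`generatorEven_domain_eq_of_weakForm_sub` — `D(T⁺) = D(T⁺′)`**, and `generatorEven_apply_of_weakForm_sub` — `T⁺′u = T⁺u − Z` with `Z` the
  correction of `B` applied to the energy coordinates of `u` (Kato's operator of a boundedly perturbed sectorial form has the same domain; here in
  the weak-image language of `SheetRGeneratorEvenWeak.mem_domainE_iff`);
* §3 the payoff on selfsim g17's S2⁺ interface (`SheetRLinearisedStabilityEvenRecord`): **`flow_sub_translationMode_le_of_pointDataE_of_weakForm_sub`** and
  **`exists_flow_sub_translationMode_le_of_pointDataE_of_weakForm_sub`** = `flow_sub_translationMode_le_of_pointDataE` / `exists_…` with the explicit binder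
  `hf : h⁺ ∈ D(T⁺′)` REPLACED by `hB`: the far-field record `MixedFarDatum (resolventEven hL K h) h⁺ h⁺ 1 …` (already a binder, stated at the
  CENTRE datum `K`) gives `h⁺ = R⁺_K(1)(g₁ + h⁺) ∈ D(T⁺_K)` (selfsim g16 `mem_domain_generatorEven_of_mixedFarDatum`) `= D(T⁺_{K′})` (§2).
No definition, no named fact, no instance, no notation.  WHAT THIS IS NOT: not NS; no interval sentence, located number, census word or
K-number moves; the `…OfRecord` / (D2)-interface compositions are NOT made here (cert lane: compose §2 with `generatorEven_reencode`).
-/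

noncomputable section

namespace Summit.NavierStokesRegularity.OSWSelfSimilar
namespace SheetRGeneratorEvenBoundedPerturbation

open _root_.MeasureTheory _root_.Set _root_.Filter SheetREnergySpace SheetRComplexPivot SheetRLinearisedTests SheetREvenTests
  SheetREvenEnergySpace SheetREvenForms SheetREvenPairUniqueness SheetREvenClass SheetRResolventEvenClass SheetRGeneratorEvenWeak
  SheetREvansEven SheetRLinearisedSemigroup SheetRLinearisedSemigroupEven SheetRSpectrumStepRule SheetRSpectrumEvenWindingLists
  SheetRSpectrumEvenPointCertificate SheetRSpectrumEvenPointCertificateA SheetRSpectrumEvenAssembly SheetREvenZeroMassCorrection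
  SheetRLinearisedStabilityEven SheetRLinearisedStabilityEvenRecord Literature.Analysis.OperatorTheory Literature.Analysis.UnboundedOperators
open scoped Topology NNReal ComplexConjugate InnerProductSpace

variable {L D₀ D₁ V₀ c m D₀' D₁' V₀' c' m' : ℝ} {d V d' V' : ℝ → ℝ}

/-! ### §1 The even zero-mass correction of a bounded term, and the weak image re-encoded -/

/-- **An `L²_w` class has an even zero-mass representative against zero-mass even tests**: for `g ∈ L²_w(ℝ)` there is `z ∈ WevenZ` with
`∫ w z v = ∫ w g v` for every ZERO-MASS even test `(v, v₁)` — `z = g_e − (L/π)(∫g_e)·w⁻¹` (selfsim g15). [folklore] -/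
theorem exists_mem_WevenZ_pairing_eq (hL : 0 < L) (g : W L) :
    ∃ z : W L, z ∈ WevenZ hL ∧ ∀ v v₁ : ℝ → ℝ, IsCompactTestE v v₁ → ∫ y, v y = 0 →
      ∫ y, (L ^ 2 + y ^ 2) * ((z : ℝ → ℝ) y * v y) = ∫ y, (L ^ 2 + y ^ 2) * ((g : ℝ → ℝ) y * v y) := by
  have hρ : ((((memLp_invWeight hL).toLp _ : W L)) : ℝ → ℝ) =ᵐ[volume] fun y => (L ^ 2 + y ^ 2)⁻¹ :=
    ae_volume_of_ae_μw hL (MemLp.coeFn_toLp _)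
  exact ⟨_, evenZ_correction_mem hL g hρ, fun v v₁ hv h0 => integral_weight_correction_mul_test hL g hρ hv h0 _⟩

/-- **Complex version**: for `G ∈ L²_w(ℂ)` there is `Z ∈ WcevenZ` whose real and imaginary parts pair with zero-mass even tests like those of
`G`. [folklore] -/
theorem exists_mem_WcevenZ_pairing_eq (hL : 0 < L) (G : Wc L) :
    ∃ Z : Wc L, Z ∈ WcevenZ hL ∧ ∀ v v₁ : ℝ → ℝ, IsCompactTestE v v₁ → ∫ y, v y = 0 →
      (∫ y, (L ^ 2 + y ^ 2) * (((reW L Z : W L) : ℝ → ℝ) y * v y) = ∫ y, (L ^ 2 + y ^ 2) * (((reW L G : W L) : ℝ → ℝ) y * v y)) ∧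
        ∫ y, (L ^ 2 + y ^ 2) * (((imW L Z : W L) : ℝ → ℝ) y * v y) = ∫ y, (L ^ 2 + y ^ 2) * (((imW L G : W L) : ℝ → ℝ) y * v y) := by
  obtain ⟨zR, hzR, hR⟩ := exists_mem_WevenZ_pairing_eq hL (reW L G)
  obtain ⟨zI, hzI, hI⟩ := exists_mem_WevenZ_pairing_eq hL (imW L G)
  have hre : reW L (ofPair L (WithLp.toLp 2 (zR, zI))) = zR := by
    rw [← (toPair_fst_snd (ofPair L (WithLp.toLp 2 (zR, zI)))).1, toPair_ofPair]; rfl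
  have him : imW L (ofPair L (WithLp.toLp 2 (zR, zI))) = zI := by
    rw [← (toPair_fst_snd (ofPair L (WithLp.toLp 2 (zR, zI)))).2, toPair_ofPair]; rfl
  refine ⟨ofPair L (WithLp.toLp 2 (zR, zI)), ofPair_mem_WcevenZ hL hzR hzI, fun v v₁ hv h0 => ?_⟩
  rw [hre, him]
  exact ⟨hR v v₁ hv h0, hI v v₁ hv h0⟩

/-- `∫ w·(g + g′)·v = ∫ w g v + ∫ w g′ v` for `L²_w` classes against a parity-free test. [folklore] -/
theorem integral_weight_add_mul (hL : 0 < L) (g g' : W L) {v v₁ : ℝ → ℝ} (hv : IsCompactTestAny v v₁) :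
    ∫ y, (L ^ 2 + y ^ 2) * ((((g + g' : W L)) : ℝ → ℝ) y * v y) =
      (∫ y, (L ^ 2 + y ^ 2) * ((g : ℝ → ℝ) y * v y)) + ∫ y, (L ^ 2 + y ^ 2) * ((g' : ℝ → ℝ) y * v y) := by
  rw [← integral_add (integrable_weight_mul_any hL g hv).1 (integrable_weight_mul_any hL g' hv).1]
  refine integral_congr_ae ?_
  filter_upwards [ae_volume_of_ae_μw hL (Lp.coeFn_add g g')] with y hy
  rw [hy, Pi.add_apply]
  ring

/-- `∫ w·(−g)·v = −∫ w g v`. [folklore] -/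
theorem integral_weight_neg_mul (hL : 0 < L) (g : W L) (v : ℝ → ℝ) :
    ∫ y, (L ^ 2 + y ^ 2) * ((((-g : W L)) : ℝ → ℝ) y * v y) = -∫ y, (L ^ 2 + y ^ 2) * ((g : ℝ → ℝ) y * v y) := by
  rw [← integral_neg]
  refine integral_congr_ae ?_
  filter_upwards [ae_volume_of_ae_μw hL (Lp.coeFn_neg g)] with y hy
  rw [hy, Pi.neg_apply]
  ring

/-- **THE EVEN WEAK IMAGE, RE-ENCODED.** If the weak forms of the encodings `(d′, V′, K′)` and `(d, V, K)` on zero-mass even tests differ by the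
bounded term `∫ w·(Bp)·φ` (`hB`), then a weak image `A⁺_{(d,V,K)}(P) = F` is a weak image `A⁺_{(d′,V′,K′)}(P) = F + Z` with `Z ∈ WcevenZ` the even
zero-mass correction of `(BP₁, BP₂)`. [folklore] -/
theorem isWeakImageE_of_weakForm_sub (hL : 0 < L) {K K' : EspE L hL →L[ℝ] W L} (B : EspE L hL →L[ℝ] W L)
    (hB : ∀ (p : EspE L hL) (φ φ₁ : ℝ → ℝ), IsCompactTestE φ φ₁ → ∫ y, φ y = 0 →
      linForm L d' V' (profile p) (derE p) φ φ₁ + ∫ y, (L ^ 2 + y ^ 2) * (((K' p : W L) : ℝ → ℝ) y * φ y) =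
        linForm L d V (profile p) (derE p) φ φ₁ + (∫ y, (L ^ 2 + y ^ 2) * (((K p : W L) : ℝ → ℝ) y * φ y))
          + ∫ y, (L ^ 2 + y ^ 2) * (((B p : W L) : ℝ → ℝ) y * φ y))
    {P : WithLp 2 (EspE L hL × EspE L hL)} {F : Wc L} (hw : IsWeakImageE hL K d V P F) :
    ∃ Z : Wc L, Z ∈ WcevenZ hL ∧ IsWeakImageE hL K' d' V' P (F + Z) := by
  obtain ⟨Z, hZ, hpair⟩ := exists_mem_WcevenZ_pairing_eq hL (ofPair L (WithLp.toLp 2 (B P.fst, B P.snd)))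
  have hre : reW L (ofPair L (WithLp.toLp 2 (B P.fst, B P.snd))) = B P.fst := by
    rw [← (toPair_fst_snd (ofPair L (WithLp.toLp 2 (B P.fst, B P.snd)))).1, toPair_ofPair]; rfl
  have him : imW L (ofPair L (WithLp.toLp 2 (B P.fst, B P.snd))) = B P.snd := by
    rw [← (toPair_fst_snd (ofPair L (WithLp.toLp 2 (B P.fst, B P.snd)))).2, toPair_ofPair]; rfl
  refine ⟨Z, hZ, fun v v₁ hv h0 => ?_⟩
  obtain ⟨h1, h2⟩ := hw v v₁ hv h0
  obtain ⟨e1, e2⟩ := hpair v v₁ hv h0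
  rw [hre] at e1
  rw [him] at e2
  have hva := hv.toIsCompactTestAny
  rw [map_add, map_add, integral_weight_add_mul hL _ _ hva, integral_weight_add_mul hL _ _ hva, hB P.fst v v₁ hv h0,
    hB P.snd v v₁ hv h0, h1, h2, e1, e2]
  exact ⟨rfl, rfl⟩

/-- The hypothesis `hB` read backwards: the weak forms of `(d, V, K)` and `(d′, V′, K′)` differ by the bounded term `−B`. [folklore] -/
theorem weakForm_sub_symm (hL : 0 < L) {K K' : EspE L hL →L[ℝ] W L} (B : EspE L hL →L[ℝ] W L)
    (hB : ∀ (p : EspE L hL) (φ φ₁ : ℝ → ℝ), IsCompactTestE φ φ₁ → ∫ y, φ y = 0 →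
      linForm L d' V' (profile p) (derE p) φ φ₁ + ∫ y, (L ^ 2 + y ^ 2) * (((K' p : W L) : ℝ → ℝ) y * φ y) =
        linForm L d V (profile p) (derE p) φ φ₁ + (∫ y, (L ^ 2 + y ^ 2) * (((K p : W L) : ℝ → ℝ) y * φ y))
          + ∫ y, (L ^ 2 + y ^ 2) * (((B p : W L) : ℝ → ℝ) y * φ y))
    (p : EspE L hL) (φ φ₁ : ℝ → ℝ) (hφ : IsCompactTestE φ φ₁) (h0 : ∫ y, φ y = 0) :
    linForm L d V (profile p) (derE p) φ φ₁ + ∫ y, (L ^ 2 + y ^ 2) * (((K p : W L) : ℝ → ℝ) y * φ y) =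
      linForm L d' V' (profile p) (derE p) φ φ₁ + (∫ y, (L ^ 2 + y ^ 2) * (((K' p : W L) : ℝ → ℝ) y * φ y))
        + ∫ y, (L ^ 2 + y ^ 2) * ((((-B) p : W L) : ℝ → ℝ) y * φ y) := by
  rw [neg_apply, integral_weight_neg_mul hL, hB p φ φ₁ hφ h0]
  ring

/-! ### §2 Kato's operator: same domain, action shifted by the correction -/

/-- **`D(T⁺)` IS INVARIANT UNDER BOUNDED RE-ENCODINGS OF THE FORM.** For (S1⁺) data `h` of `(d, V, K)` and `h′` of `(d′, V′, K′)` whose weak forms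
differ by a bounded term (`hB`), and any base points `Re σ₀ > −m`, `Re σ₁ > −m′`:
`(generatorEven hL K h σ₀ _).domain = (generatorEven hL K′ h′ σ₁ _).domain`. In words: the domain of Kato's closed operator of a boundedly
perturbed Gårding form does not see the perturbation. 1-D MODEL frame; not NS. [folklore] -/
theorem generatorEven_domain_eq_of_weakForm_sub (hL : 0 < L) {K K' : EspE L hL →L[ℝ] W L}
    (h : GardingDataKE L hL d V K D₀ D₁ V₀ c m) (h' : GardingDataKE L hL d' V' K' D₀' D₁' V₀' c' m') (B : EspE L hL →L[ℝ] W L)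
    (hB : ∀ (p : EspE L hL) (φ φ₁ : ℝ → ℝ), IsCompactTestE φ φ₁ → ∫ y, φ y = 0 →
      linForm L d' V' (profile p) (derE p) φ φ₁ + ∫ y, (L ^ 2 + y ^ 2) * (((K' p : W L) : ℝ → ℝ) y * φ y) =
        linForm L d V (profile p) (derE p) φ φ₁ + (∫ y, (L ^ 2 + y ^ 2) * (((K p : W L) : ℝ → ℝ) y * φ y))
          + ∫ y, (L ^ 2 + y ^ 2) * (((B p : W L) : ℝ → ℝ) y * φ y))
    {σ₀ σ₁ : ℂ} (hσ₀ : -m < σ₀.re) (hσ₁ : -m' < σ₁.re) :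
    (generatorEven hL K h σ₀ hσ₀).domain = (generatorEven hL K' h' σ₁ hσ₁).domain := by
  ext u
  rw [mem_domainE_iff hL K h hσ₀, mem_domainE_iff hL K' h' hσ₁]
  constructor
  · rintro ⟨P, F, hP, hw⟩
    obtain ⟨Z, hZ, hw'⟩ := isWeakImageE_of_weakForm_sub hL B hB hw
    exact ⟨P, ⟨(F : Wc L) + Z, (WcevenZ hL).add_mem F.2 hZ⟩, hP, hw'⟩
  · rintro ⟨P, F, hP, hw⟩
    obtain ⟨Z, hZ, hw'⟩ := isWeakImageE_of_weakForm_sub hL (-B) (weakForm_sub_symm hL B hB) hw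
    exact ⟨P, ⟨(F : Wc L) + Z, (WcevenZ hL).add_mem F.2 hZ⟩, hP, hw'⟩

/-- **The action, re-encoded**: for `u ∈ D(T⁺)` with energy coordinates `P` (`toPair u = ιpairE P`), `u ∈ D(T⁺′)` and `T⁺′u = T⁺u − Z` where
`Z ∈ WcevenZ` pairs with zero-mass even tests like `(BP₁, BP₂)` — the bounded perturbation acts through its even zero-mass correction. [folklore] -/
theorem generatorEven_apply_of_weakForm_sub (hL : 0 < L) {K K' : EspE L hL →L[ℝ] W L}
    (h : GardingDataKE L hL d V K D₀ D₁ V₀ c m) (h' : GardingDataKE L hL d' V' K' D₀' D₁' V₀' c' m') (B : EspE L hL →L[ℝ] W L)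
    (hB : ∀ (p : EspE L hL) (φ φ₁ : ℝ → ℝ), IsCompactTestE φ φ₁ → ∫ y, φ y = 0 →
      linForm L d' V' (profile p) (derE p) φ φ₁ + ∫ y, (L ^ 2 + y ^ 2) * (((K' p : W L) : ℝ → ℝ) y * φ y) =
        linForm L d V (profile p) (derE p) φ φ₁ + (∫ y, (L ^ 2 + y ^ 2) * (((K p : W L) : ℝ → ℝ) y * φ y))
          + ∫ y, (L ^ 2 + y ^ 2) * (((B p : W L) : ℝ → ℝ) y * φ y))
    {σ₀ σ₁ : ℂ} (hσ₀ : -m < σ₀.re) (hσ₁ : -m' < σ₁.re) {u : WcevenZ hL} (hu : u ∈ (generatorEven hL K h σ₀ hσ₀).domain) :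
    ∃ (hu' : u ∈ (generatorEven hL K' h' σ₁ hσ₁).domain) (P : WithLp 2 (EspE L hL × EspE L hL)) (Z : Wc L),
      toPair L (u : Wc L) = ιpairE hL P ∧ Z ∈ WcevenZ hL ∧
      ((generatorEven hL K' h' σ₁ hσ₁ ⟨u, hu'⟩ : WcevenZ hL) : Wc L) = ((generatorEven hL K h σ₀ hσ₀ ⟨u, hu⟩ : WcevenZ hL) : Wc L) - Z ∧
      ∀ v v₁ : ℝ → ℝ, IsCompactTestE v v₁ → ∫ y, v y = 0 →
        (∫ y, (L ^ 2 + y ^ 2) * (((reW L Z : W L) : ℝ → ℝ) y * v y) = ∫ y, (L ^ 2 + y ^ 2) * (((B P.fst : W L) : ℝ → ℝ) y * v y)) ∧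
          ∫ y, (L ^ 2 + y ^ 2) * (((imW L Z : W L) : ℝ → ℝ) y * v y) = ∫ y, (L ^ 2 + y ^ 2) * (((B P.snd : W L) : ℝ → ℝ) y * v y) := by
  obtain ⟨P, hP, hw⟩ := weak_of_mem_domainE hL K h hσ₀ hu
  obtain ⟨Z, hZ, hpair⟩ := exists_mem_WcevenZ_pairing_eq hL (ofPair L (WithLp.toLp 2 (B P.fst, B P.snd)))
  have hre : reW L (ofPair L (WithLp.toLp 2 (B P.fst, B P.snd))) = B P.fst := by
    rw [← (toPair_fst_snd (ofPair L (WithLp.toLp 2 (B P.fst, B P.snd)))).1, toPair_ofPair]; rfl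
  have him : imW L (ofPair L (WithLp.toLp 2 (B P.fst, B P.snd))) = B P.snd := by
    rw [← (toPair_fst_snd (ofPair L (WithLp.toLp 2 (B P.fst, B P.snd)))).2, toPair_ofPair]; rfl
  set T : Wc L := ((generatorEven hL K h σ₀ hσ₀ ⟨u, hu⟩ : WcevenZ hL) : Wc L) with hT
  have hw' : IsWeakImageE hL K' d' V' P (-T + Z) := by
    intro v v₁ hv h0
    obtain ⟨h1, h2⟩ := hw v v₁ hv h0
    obtain ⟨e1, e2⟩ := hpair v v₁ hv h0
    rw [hre] at e1
    rw [him] at e2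
    have hva := hv.toIsCompactTestAny
    rw [map_add, map_add, integral_weight_add_mul hL _ _ hva, integral_weight_add_mul hL _ _ hva, hB P.fst v v₁ hv h0,
      hB P.snd v v₁ hv h0, h1, h2, e1, e2]
    exact ⟨rfl, rfl⟩
  have hmem : -T + Z ∈ WcevenZ hL := (WcevenZ hL).add_mem ((WcevenZ hL).neg_mem (generatorEven hL K h σ₀ hσ₀ ⟨u, hu⟩).2) hZ
  obtain ⟨hu', hT'⟩ := mem_domain_of_weakE hL K' h' hσ₁ (u := u) (F := ⟨-T + Z, hmem⟩) hP hw'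
  refine ⟨hu', P, Z, hP, hZ, ?_, fun v v₁ hv h0 => ?_⟩
  · rw [hT', Submodule.coe_neg]
    show -(-T + Z) = T - Z
    abel
  · obtain ⟨e1, e2⟩ := hpair v v₁ hv h0
    rw [hre] at e1
    rw [him] at e2
    exact ⟨e1, e2⟩

/-! ### §3 The even stability word on the S2⁺ interface WITHOUT the domain binder -/

variable (hL : 0 < L) [CompleteSpace (WcevenZ hL)] (K : EspE L hL →L[ℝ] W L) (h : GardingDataKE L hL d V K D₀ D₁ V₀ c m)
  (K' : EspE L hL →L[ℝ] W L) (h' : GardingDataKE L hL d' V' K' D₀' D₁' V₀' c' m')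

/-- **«LINEARLY STABLE MODULO TRANSLATION» (MODEL) ON THE S2⁺ INTERFACE, NO DOMAIN BINDER.** `flow_sub_translationMode_le_of_pointDataE` (selfsim
g17) with its explicit binder `hf : h⁺ ∈ D(T⁺*)` REPLACED by the bounded re-encoding hypothesis `hB` between the centre datum `(d, V, K)` and the
perturbed datum `(d′, V′, K′)`: the far-field record `hF` (stated at the centre datum) puts `h⁺` in `D(T⁺_K) = D(T⁺_{K′})`
(`mem_domain_generatorEven_of_mixedFarDatum` + `generatorEven_domain_eq_of_weakForm_sub`). All other hypotheses and the conclusion verbatim.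
1-D MODEL; NOT NS; nothing is asserted to hold. [folklore] -/
theorem flow_sub_translationMode_le_of_pointDataE_of_weakForm_sub (hm : (3 : ℝ) / 20 ≤ m) (hm' : -m' < ra) (hv : WcevenZ hL) (θ : ℂ) (hθ : ‖θ‖ ≤ 4)
    (hsym : ∀ w, evansEven hL K h (innerSL ℂ hv) hv θ (conj w) = conj (evansEven hL K h (innerSL ℂ hv) hv θ w))
    {pert : ℝ} (hpert : ∀ w : ℂ, ra ≤ w.re →
      ‖evansEven hL K' h' (innerSL ℂ hv) hv θ w - evansEven hL K h (innerSL ℂ hv) hv θ w‖ ≤ pert) (hpert' : pert ≤ (1107 : ℝ) / 200000)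
    (hP : PointDataE (resolventEven hL K h) hv hv θ (evansEven hL K h (innerSL ℂ hv) hv θ))
    (hF : MixedFarDatum (resolventEven hL K h) hv hv 1 ((10075811313 : ℝ) / 10000000000) ((754639259 : ℝ) / 200000000)
      ((1011518153 : ℝ) / 250000000) ((4049925993 : ℝ) / 1000000000))
    {v : WcevenZ hL} (hv0 : v ≠ 0)
    (hv1 : ∃ hu : v ∈ (generatorEven hL K' h' ((1 : ℂ) / 2) (lt_trans hm' ra_lt_half_re)).domain,
      generatorEven hL K' h' ((1 : ℂ) / 2) (lt_trans hm' ra_lt_half_re) ⟨v, hu⟩ = ((1 : ℂ) / 2) • v - (θ * innerSL ℂ hv v) • hv)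
    {σ₀ : ℂ} (hσ₀ : -m' < σ₀.re) (S SF : C0Semigroup ℂ (WcevenZ hL))
    (hS : S.generator = generatorEven hL K' h' σ₀ hσ₀) (hSM : ∀ τ : ℝ≥0, ‖S.app τ‖ ≤ Real.exp (-m' * τ))
    (hlap : ∀ σ : ℂ, -m' < σ.re → ∀ G : WcevenZ hL, S.laplaceResolventFun σ G = resolventEven hL K' h' σ G)
    (hdomF : (SF.generator.domain : Set (WcevenZ hL)) = (generatorEven hL K' h' σ₀ hσ₀).domain)
    (hgenF : ∀ (u : WcevenZ hL) (hu : u ∈ (generatorEven hL K' h' σ₀ hσ₀).domain), ∃ hu' : u ∈ SF.generator.domain,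
      SF.generator ⟨u, hu'⟩ = generatorEven hL K' h' σ₀ hσ₀ ⟨u, hu⟩ + (θ * innerSL ℂ hv u) • hv)
    (B : EspE L hL →L[ℝ] W L)
    (hB : ∀ (p : EspE L hL) (φ φ₁ : ℝ → ℝ), IsCompactTestE φ φ₁ → ∫ y, φ y = 0 →
      linForm L d' V' (profile p) (derE p) φ φ₁ + ∫ y, (L ^ 2 + y ^ 2) * (((K' p : W L) : ℝ → ℝ) y * φ y) =
        linForm L d V (profile p) (derE p) φ φ₁ + (∫ y, (L ^ 2 + y ^ 2) * (((K p : W L) : ℝ → ℝ) y * φ y))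
          + ∫ y, (L ^ 2 + y ^ 2) * (((B p : W L) : ℝ → ℝ) y * φ y))
    {β' : ℝ} (hβ' : 0 < β') (hβ'3 : β' < (3 : ℝ) / 100) :
    ∃ M : ℝ, ∀ (δ₀ : WcevenZ hL) (t : ℝ), 0 ≤ t →
      ‖SF.app t.toNNReal δ₀ -
        ((deriv (evansEven hL K' h' (innerSL ℂ hv) hv θ) (1 / 2))⁻¹ * (θ * innerSL ℂ hv (resolventEven hL K' h' (1 / 2) δ₀)) *
            (Real.exp (t / 2) : ℂ)) • resolventEven hL K' h' (1 / 2) hv‖ ≤ M * ‖δ₀‖ * Real.exp (-β' * t) := by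
  have h1m : -m < (1 : ℂ).re := by rw [Complex.one_re]; linarith
  have hf : hv ∈ (generatorEven hL K' h' σ₀ hσ₀).domain := by
    rw [← generatorEven_domain_eq_of_weakForm_sub hL h h' B hB h1m hσ₀]
    exact mem_domain_generatorEven_of_mixedFarDatum hL K h h1m h1m hF
  exact flow_sub_translationMode_le_of_pointDataE hL K h K' h' hm hm' hv θ hθ hsym hpert hpert' hP hF hv0 hv1 hσ₀ S SF hS hSM hlap
    hdomF hgenF hf hβ' hβ'3

/-- **THE LINEARISED EVEN FLOW EXISTS AND IS LINEARLY STABLE MODULO TRANSLATION (MODEL), NO DOMAIN BINDER** — existence form: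
`exists_flow_sub_translationMode_le_of_pointDataE` (selfsim g17; `S`, `S_F` produced by `exists_c0SemigroupE` / `exists_c0Semigroup_fullE`) with
`hf` REPLACED by `hB`. Hypotheses = the two (S1⁺) data, the S2⁺ interface (point records of implementation 2, far-field datum, allowance, symmetry,
one eigenvector at `1/2`) and the bounded re-encoding sentence `hB`. 1-D MODEL; NOT NS; nothing is asserted to hold. [folklore] -/
theorem exists_flow_sub_translationMode_le_of_pointDataE_of_weakForm_sub (hm : (3 : ℝ) / 20 ≤ m) (hm' : -m' < ra) (hv : WcevenZ hL) (θ : ℂ)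
    (hθ : ‖θ‖ ≤ 4)
    (hsym : ∀ w, evansEven hL K h (innerSL ℂ hv) hv θ (conj w) = conj (evansEven hL K h (innerSL ℂ hv) hv θ w))
    {pert : ℝ} (hpert : ∀ w : ℂ, ra ≤ w.re →
      ‖evansEven hL K' h' (innerSL ℂ hv) hv θ w - evansEven hL K h (innerSL ℂ hv) hv θ w‖ ≤ pert) (hpert' : pert ≤ (1107 : ℝ) / 200000)
    (hP : PointDataE (resolventEven hL K h) hv hv θ (evansEven hL K h (innerSL ℂ hv) hv θ))
    (hF : MixedFarDatum (resolventEven hL K h) hv hv 1 ((10075811313 : ℝ) / 10000000000) ((754639259 : ℝ) / 200000000)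
      ((1011518153 : ℝ) / 250000000) ((4049925993 : ℝ) / 1000000000))
    {v : WcevenZ hL} (hv0 : v ≠ 0)
    (hv1 : ∃ hu : v ∈ (generatorEven hL K' h' ((1 : ℂ) / 2) (lt_trans hm' ra_lt_half_re)).domain,
      generatorEven hL K' h' ((1 : ℂ) / 2) (lt_trans hm' ra_lt_half_re) ⟨v, hu⟩ = ((1 : ℂ) / 2) • v - (θ * innerSL ℂ hv v) • hv)
    (B : EspE L hL →L[ℝ] W L)
    (hB : ∀ (p : EspE L hL) (φ φ₁ : ℝ → ℝ), IsCompactTestE φ φ₁ → ∫ y, φ y = 0 →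
      linForm L d' V' (profile p) (derE p) φ φ₁ + ∫ y, (L ^ 2 + y ^ 2) * (((K' p : W L) : ℝ → ℝ) y * φ y) =
        linForm L d V (profile p) (derE p) φ φ₁ + (∫ y, (L ^ 2 + y ^ 2) * (((K p : W L) : ℝ → ℝ) y * φ y))
          + ∫ y, (L ^ 2 + y ^ 2) * (((B p : W L) : ℝ → ℝ) y * φ y))
    {β' : ℝ} (hβ' : 0 < β') (hβ'3 : β' < (3 : ℝ) / 100) :
    ∃ (S SF : C0Semigroup ℂ (WcevenZ hL)) (hσ₀ : -m' < (((‖(θ • innerSL ℂ hv).smulRight hv‖ : ℝ) : ℂ)).re),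
      S.generator = generatorEven hL K' h' _ hσ₀ ∧ (∀ τ : ℝ≥0, ‖S.app τ‖ ≤ Real.exp (-m' * τ)) ∧
      (∀ σ : ℂ, -m' < σ.re → ∀ G : WcevenZ hL, S.laplaceResolventFun σ G = resolventEven hL K' h' σ G) ∧
      ((SF.generator.domain : Set (WcevenZ hL)) = (generatorEven hL K' h' _ hσ₀).domain) ∧
      (∀ (u : WcevenZ hL) (hu : u ∈ (generatorEven hL K' h' _ hσ₀).domain), ∃ hu' : u ∈ SF.generator.domain,
        SF.generator ⟨u, hu'⟩ = generatorEven hL K' h' _ hσ₀ ⟨u, hu⟩ + (θ * innerSL ℂ hv u) • hv) ∧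
      ∃ M : ℝ, ∀ (δ₀ : WcevenZ hL) (t : ℝ), 0 ≤ t →
        ‖SF.app t.toNNReal δ₀ -
          ((deriv (evansEven hL K' h' (innerSL ℂ hv) hv θ) (1 / 2))⁻¹ * (θ * innerSL ℂ hv (resolventEven hL K' h' (1 / 2) δ₀)) *
              (Real.exp (t / 2) : ℂ)) • resolventEven hL K' h' (1 / 2) hv‖ ≤ M * ‖δ₀‖ * Real.exp (-β' * t) := by
  have h1m : -m < (1 : ℂ).re := by rw [Complex.one_re]; linarith
  have hf : hv ∈ (generatorEven hL K' h' ((1 : ℂ) / 2) (lt_trans hm' ra_lt_half_re)).domain := by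
    rw [← generatorEven_domain_eq_of_weakForm_sub hL h h' B hB h1m (lt_trans hm' ra_lt_half_re)]
    exact mem_domain_generatorEven_of_mixedFarDatum hL K h h1m h1m hF
  exact exists_flow_sub_translationMode_le_of_pointDataE hL K h K' h' hm hm' hv θ hθ hsym hpert hpert' hP hF hv0 hv1 hf hβ' hβ'3

end SheetRGeneratorEvenBoundedPerturbation
end Summit.NavierStokesRegularity.OSWSelfSimilar

end
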